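import Literature.NumberTheory.EllipticCurves.IwasawaSelmerControlCokerLemmas
import HarnessLib

/-!
# Greenberg's Lemma 3.2: discharge of `Greenberg1999_layerInvariants_le_range`

Second proof file for the named fact `WeierstrassCurve.Greenberg1999_layerInvariants_le_range` of
`Literature.NumberTheory.EllipticCurves.IwasawaSelmerControl` (Greenberg, LNM 1716, §3, Lemma 3.2,
p. 86 of the held copy: "`Coker(h_n) = 0`", the restriction
`h_n : H¹(K_n, E[p^∞]) → H¹(K_∞, E[p^∞])^{Γ_n}` is onto). Printed proof: exactness of
`H¹(F_n, E[p^∞]) → H¹(F_∞, E[p^∞])^{Γ_n} → H²(Γ_n, B)` and `H²(Γ_n, B) = 0` since `Γ_n ≅ ℤ_p` is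
free pro-`p`. As the tree has no `H²`, we prove the statement directly on continuous cocycles
(the classical argument behind `cd_p(ℤ_p) = 1`, Serre, *Galois Cohomology*, I.§3.4 and I.§5.1),
for an arbitrary discrete `p`-primary `Γ_K`-module `M` with continuous orbit maps and an arbitrary
`ℤ_p`-extension `κ` (`H = ker κ = Gal(K̄/K_∞)`, `H' = κ⁻¹(pⁿℤ_p) = Gal(K̄/K_n)`, `γ = γ₀^{pⁿ}` with
`κ γ₀ = 1`):

1. (`IwasawaSelmerControlCokerLemmas`) a class `[c] ∈ H¹(H, M)` fixed by `conj_γ` gives `m` with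
   `γ c(γ⁻¹τγ) - c(τ) = τ m - m`, the sums `s_k` and the pair cocycle `F(k, τ) = s_k + γ^k c(τ)`.
2. `extFun`: the crossed homomorphism `γ^k τ ↦ F(k, τ)` on the monoid `S = {γ^k τ : k ≥ 0, τ ∈ H}`
   (well defined since `k` is determined by `κ`, `eq_of_toAdd_eq`); `extFun_mul` (crossed
   homomorphism), `smul_extFun` (its values are fixed by a small open normal subgroup `V`,
   `exists_good_subgroup`: `V ∩ H ⊆ ker c`, `V` fixes `m` and `c(H)`; such `V` exists by
   profiniteness of `Γ_K`, `ProfiniteGrp.exist_openNormalSubgroup_sub_open_nhds_of_one`).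
3. **Automatic continuity** (`extFun_eq_zero`): on `S ∩ V` the map is additive; with `u ∈ V ∩ S` of
   coordinate `p^A` (`exists_forall_exists_toAdd_eq`) and `p^f` killing `extFun u` (`M` is
   `p`-primary), `extFun` vanishes on `S ∩ V ∩ Gal(K̄/K_{n+A+f})` (`pow_dvd_of_mem_layerSubgroup`,
   `extFun_pow`). This is where `H'/H ≅ ℤ_p` being pro-`p` and `M` being `p`-primary meet.
4. `exists_extend`: every `g ∈ H'` is `s v` with `s ∈ S`, `v ∈ V_f` (`exists_eq_pow_mul_mul`);
   `b(g) = extFun s` is well defined (`extFun_eq_of_inv_mul_mem`), locally constant hence continuous,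
   a cocycle, and restricts to `c` on `H`.
5. `mem_range_resOfLe_of_conjH1_eq`: hence `res : H¹(H', M) → H¹(H, M)` hits every `conj_γ`-fixed
   class; `WeierstrassCurve.Greenberg1999_layerInvariants_le_range_holds` is the case `M = E[p^∞]`
   (`layerInvariants` asks invariance under all of `H'`, of which only `γ` is used). The hypotheses
   `[W.IsElliptic]` and `κ.IsCyclotomic` of the fact are not used.

## References

* R. Greenberg, *Iwasawa theory for elliptic curves*, LNM 1716 (1999), §3, Lemma 3.2 (held copy
  `book:coatesnd-arithmetic-theory-elliptic-curves`, PDF p. 86).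
* J.-P. Serre, *Galois Cohomology* (1997), I.§2.6 (restriction to a closed normal subgroup,
  `H¹(G, A) → H¹(H, A)^{G/H} → H²(G/H, A^H)`), I.§3.4 (`cd(ℤ_p) = 1`), I.§5.1.
-/

noncomputable section

open scoped Classical

open Literature.NumberTheory.EllipticCurves Literature.NumberTheory.GaloisRepresentations
  Literature.NumberTheory.EllipticCurves.LayerCocycle

universe u

namespace Literature.NumberTheory.EllipticCurves.ZpExtension

variable {K : Type u} [Field K] [CharZero K] {p : ℕ} [Fact p.Prime] (κ : ZpExtension K p)
variable {M : Type u} [AddCommGroup M] [DistribMulAction (Field.absoluteGaloisGroup K) M]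
  [TopologicalSpace M] [DiscreteTopology M]
variable (n : ℕ) (γ₀ : Field.absoluteGaloisGroup K)

/-! ## The monoid `S = {γ^k τ}` and the function `extFun` -/

omit [CharZero K] in
/-- Membership in the monoid `S = {γ^k τ : k ∈ ℕ, τ ∈ Gal(K̄/K_∞)}`, `γ = γ₀^{pⁿ}` (as a predicate on
`Γ_K`, with the witness packaged as a pair). [folklore] -/
def InS (g : Field.absoluteGaloisGroup K) : Prop :=
  ∃ kτ : ℕ × Field.absoluteGaloisGroup K, kτ.2 ∈ κ.kerSubgroup ∧ g = (γ₀ ^ p ^ n) ^ kτ.1 * kτ.2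

variable {κ n γ₀}

omit [CharZero K] in
/-- `γ^k τ ∈ S`. [folklore] -/
theorem inS_pow_mul (k : ℕ) {τ : Field.absoluteGaloisGroup K} (hτ : τ ∈ κ.kerSubgroup) :
    InS κ n γ₀ ((γ₀ ^ p ^ n) ^ k * τ) :=
  ⟨(k, τ), hτ, rfl⟩

omit [CharZero K] in
/-- `Gal(K̄/K_∞) ⊆ S` (`k = 0`). [folklore] -/
theorem inS_of_mem {τ : Field.absoluteGaloisGroup K} (hτ : τ ∈ κ.kerSubgroup) : InS κ n γ₀ τ :=
  ⟨(0, τ), hτ, by rw [pow_zero, one_mul]⟩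

omit [CharZero K] in
/-- `γ^{-k} τ γ^k ∈ Gal(K̄/K_∞)` for `τ ∈ Gal(K̄/K_∞)` (normality). [folklore] -/
theorem conj_pow_mem (k : ℕ) {τ : Field.absoluteGaloisGroup K} (hτ : τ ∈ κ.kerSubgroup) :
    ((γ₀ ^ p ^ n) ^ k)⁻¹ * τ * (γ₀ ^ p ^ n) ^ k ∈ κ.kerSubgroup := by
  have h := (inferInstance : κ.kerSubgroup.Normal).conj_mem τ hτ ((γ₀ ^ p ^ n) ^ k)⁻¹
  rwa [inv_inv] at h

omit [CharZero K] in
/-- `S` is closed under multiplication: `(γ^j τ)(γ^k τ') = γ^{j+k} (γ^{-k} τ γ^k) τ'`. [folklore] -/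
theorem InS.mul {g g' : Field.absoluteGaloisGroup K} (hg : InS κ n γ₀ g) (hg' : InS κ n γ₀ g') :
    InS κ n γ₀ (g * g') := by
  obtain ⟨⟨j, τ⟩, hτ, rfl⟩ := hg
  obtain ⟨⟨k, τ'⟩, hτ', rfl⟩ := hg'
  dsimp only at hτ hτ' ⊢
  exact ⟨(j + k, ((γ₀ ^ p ^ n) ^ k)⁻¹ * τ * (γ₀ ^ p ^ n) ^ k * τ'),
    mul_mem (conj_pow_mem k hτ) hτ', by rw [pow_add]; group⟩

omit [CharZero K] in
/-- `S` is closed under powers. [folklore] -/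
theorem InS.pow {g : Field.absoluteGaloisGroup K} (hg : InS κ n γ₀ g) (N : ℕ) :
    InS κ n γ₀ (g ^ N) := by
  induction N with
  | zero => rw [pow_zero]; exact inS_of_mem (one_mem _)
  | succ N ih => rw [pow_succ]; exact ih.mul hg

omit [CharZero K] in
/-- `S ⊆ Gal(K̄/K_n)`. [folklore] -/
theorem InS.mem_layerSubgroup (hγ₀ : κ.IsTopGenerator γ₀) {g : Field.absoluteGaloisGroup K}
    (hg : InS κ n γ₀ g) : g ∈ κ.layerSubgroup n := by
  obtain ⟨⟨k, τ⟩, hτ, rfl⟩ := hg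
  dsimp only at hτ ⊢
  exact mul_mem (pow_mem (κ.pow_mem_layerSubgroup hγ₀ n) k) (κ.kerSubgroup_le_layerSubgroup n hτ)

variable (κ n γ₀)
variable (c : contOneCocycles (discreteTopRep κ.kerSubgroup M)) (m : M)

omit [CharZero K] in
/-- **The would-be extension of `c` to the monoid `S`**: `extFun (γ^k τ) = F(k, τ) = s_k + γ^k c(τ)`
(and `0` off `S`); well defined because `k`, hence `τ`, is determined by `γ^k τ` (`extFun_eq`).
Serre, *Galois Cohomology*, I.§5.1. [folklore] -/
def extFun (g : Field.absoluteGaloisGroup K) : M :=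
  if h : InS κ n γ₀ g then
    pairF κ.kerSubgroup (γ₀ ^ p ^ n) m c h.choose.1 ⟨h.choose.2, h.choose_spec.1⟩
  else 0

variable {κ n γ₀ c m}

omit [CharZero K] in
/-- **`extFun (γ^k τ) = F(k, τ)`**: the coordinate `k` is unique (`eq_of_toAdd_eq`). [folklore] -/
theorem extFun_eq (hγ₀ : κ.IsTopGenerator γ₀) (k : ℕ) {τ : Field.absoluteGaloisGroup K}
    (hτ : τ ∈ κ.kerSubgroup) :
    extFun κ n γ₀ c m ((γ₀ ^ p ^ n) ^ k * τ) =
      pairF κ.kerSubgroup (γ₀ ^ p ^ n) m c k ⟨τ, hτ⟩ := by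
  have h : InS κ n γ₀ ((γ₀ ^ p ^ n) ^ k * τ) := inS_pow_mul k hτ
  rw [extFun, dif_pos h]
  obtain ⟨hτ', heq⟩ := h.choose_spec
  have hk : h.choose.1 = k := κ.eq_of_toAdd_eq hγ₀ n hτ' hτ (congrArg κ heq.symm)
  have hτeq : h.choose.2 = τ := by
    have e := heq
    rw [hk] at e
    exact (mul_left_cancel e).symm
  have key : ∀ (k' : ℕ) (τ' : Field.absoluteGaloisGroup K) (h' : τ' ∈ κ.kerSubgroup),
      k' = k → τ' = τ →
        pairF κ.kerSubgroup (γ₀ ^ p ^ n) m c k' ⟨τ', h'⟩ =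
          pairF κ.kerSubgroup (γ₀ ^ p ^ n) m c k ⟨τ, hτ⟩ := by
    rintro k' τ' h' rfl rfl
    rfl
  exact key _ _ _ hk hτeq

omit [CharZero K] in
/-- `extFun τ = c(τ)` on `Gal(K̄/K_∞)`. [folklore] -/
theorem extFun_of_mem (hγ₀ : κ.IsTopGenerator γ₀) {τ : Field.absoluteGaloisGroup K}
    (hτ : τ ∈ κ.kerSubgroup) : extFun κ n γ₀ c m τ = c.1 ⟨τ, hτ⟩ := by
  have h := extFun_eq (n := n) (c := c) (m := m) hγ₀ 0 hτ
  rwa [pow_zero, one_mul, pairF_zero] at h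

omit [CharZero K] in
/-- `extFun 1 = 0`. [folklore] -/
theorem extFun_one (hγ₀ : κ.IsTopGenerator γ₀) : extFun κ n γ₀ c m 1 = 0 := by
  rw [extFun_of_mem hγ₀ (one_mem _)]
  exact contOneCocycles.apply_one c

omit [CharZero K] in
/-- **`extFun` is a crossed homomorphism on `S`** (the pair cocycle identity `pairF_mul`).
Serre, *Galois Cohomology*, I.§5.1. [folklore] -/
theorem extFun_mul (hγ₀ : κ.IsTopGenerator γ₀)
    (hm : ∀ τ : κ.kerSubgroup, γ₀ ^ p ^ n • c.1 (subgroupConj κ.kerSubgroup (γ₀ ^ p ^ n) τ) - c.1 τ =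
      (τ : Field.absoluteGaloisGroup K) • m - m)
    {g g' : Field.absoluteGaloisGroup K} (hg : InS κ n γ₀ g) (hg' : InS κ n γ₀ g') :
    extFun κ n γ₀ c m (g * g') = extFun κ n γ₀ c m g + g • extFun κ n γ₀ c m g' := by
  obtain ⟨⟨j, τ⟩, hτ, rfl⟩ := hg
  obtain ⟨⟨k, τ'⟩, hτ', rfl⟩ := hg'
  dsimp only at hτ hτ' ⊢
  have hconj := conj_pow_mem (κ := κ) (n := n) (γ₀ := γ₀) k hτ
  have e : (γ₀ ^ p ^ n) ^ j * τ * ((γ₀ ^ p ^ n) ^ k * τ') =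
      (γ₀ ^ p ^ n) ^ (j + k) * (((γ₀ ^ p ^ n) ^ k)⁻¹ * τ * (γ₀ ^ p ^ n) ^ k * τ') := by
    rw [pow_add]; group
  rw [e, extFun_eq hγ₀ (j + k) (mul_mem hconj hτ'), extFun_eq hγ₀ j hτ, extFun_eq hγ₀ k hτ']
  have e2 : (⟨((γ₀ ^ p ^ n) ^ k)⁻¹ * τ * (γ₀ ^ p ^ n) ^ k * τ', mul_mem hconj hτ'⟩ : κ.kerSubgroup) =
      subgroupConj κ.kerSubgroup ((γ₀ ^ p ^ n) ^ k) ⟨τ, hτ⟩ * ⟨τ', hτ'⟩ :=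
    Subtype.ext rfl
  rw [e2, pairF_mul κ.kerSubgroup (γ₀ ^ p ^ n) m c hm j k]

omit [CharZero K] in
/-- The values of `extFun` on `S` are fixed by a normal subgroup `V` fixing `m` and `c(H)`.
[folklore] -/
theorem smul_extFun (hγ₀ : κ.IsTopGenerator γ₀) (V : Subgroup (Field.absoluteGaloisGroup K))
    [V.Normal] (hVm : ∀ v ∈ V, v • m = m) (hVc : ∀ v ∈ V, ∀ τ : κ.kerSubgroup, v • c.1 τ = c.1 τ)
    {v : Field.absoluteGaloisGroup K} (hv : v ∈ V) {g : Field.absoluteGaloisGroup K}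
    (hg : InS κ n γ₀ g) : v • extFun κ n γ₀ c m g = extFun κ n γ₀ c m g := by
  obtain ⟨⟨k, τ⟩, hτ, rfl⟩ := hg
  dsimp only at hτ ⊢
  rw [extFun_eq hγ₀ k hτ]
  exact smul_pairF κ.kerSubgroup (γ₀ ^ p ^ n) m c V hVm hVc hv k ⟨τ, hτ⟩

omit [CharZero K] in
/-- On powers of an element `u ∈ S ∩ V`: `extFun (u^N) = N • extFun u` (`extFun` is additive on
`S ∩ V`). [folklore] -/
theorem extFun_pow (hγ₀ : κ.IsTopGenerator γ₀)
    (hm : ∀ τ : κ.kerSubgroup, γ₀ ^ p ^ n • c.1 (subgroupConj κ.kerSubgroup (γ₀ ^ p ^ n) τ) - c.1 τ =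
      (τ : Field.absoluteGaloisGroup K) • m - m)
    (V : Subgroup (Field.absoluteGaloisGroup K)) [V.Normal] (hVm : ∀ v ∈ V, v • m = m)
    (hVc : ∀ v ∈ V, ∀ τ : κ.kerSubgroup, v • c.1 τ = c.1 τ) {u : Field.absoluteGaloisGroup K}
    (hu : InS κ n γ₀ u) (huV : u ∈ V) (N : ℕ) :
    extFun κ n γ₀ c m (u ^ N) = N • extFun κ n γ₀ c m u := by
  induction N with
  | zero => rw [pow_zero, zero_nsmul, extFun_one hγ₀]
  | succ N ih =>
    rw [pow_succ, extFun_mul hγ₀ hm (hu.pow N) hu, ih,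
      smul_extFun hγ₀ V hVm hVc (V.pow_mem huV N) hu, succ_nsmul]

omit [CharZero K] in
/-- **Automatic continuity: `extFun` vanishes deep inside `S ∩ V`.** Let `u = γ^{p^A} τ_a ∈ V ∩ S`
and `p^f • extFun u = 0`. Then `extFun w = 0` for every `w ∈ S ∩ V ∩ Gal(K̄/K_{n+A+f})`: the
coordinate of `w` is `p^{A+f} j` (`pow_dvd_of_mem_layerSubgroup`), so `w = u^{p^f j} w'` with
`w' ∈ V ∩ Gal(K̄/K_∞)`, where `c` vanishes, and `extFun (u^{p^f j}) = j p^f • extFun u = 0`. This is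
the step that uses that `M` is `p`-primary and `H'/H ≅ ℤ_p` is pro-`p` (Serre, I.§3.4,
`cd_p(ℤ_p) = 1`). [folklore] -/
theorem extFun_eq_zero (hγ₀ : κ.IsTopGenerator γ₀)
    (hm : ∀ τ : κ.kerSubgroup, γ₀ ^ p ^ n • c.1 (subgroupConj κ.kerSubgroup (γ₀ ^ p ^ n) τ) - c.1 τ =
      (τ : Field.absoluteGaloisGroup K) • m - m)
    (V : Subgroup (Field.absoluteGaloisGroup K)) [V.Normal] (hVm : ∀ v ∈ V, v • m = m)
    (hVc : ∀ v ∈ V, ∀ τ : κ.kerSubgroup, v • c.1 τ = c.1 τ)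
    (hVZ : ∀ v ∈ V, ∀ hv : v ∈ κ.kerSubgroup, c.1 ⟨v, hv⟩ = 0)
    {A : ℕ} {τa : Field.absoluteGaloisGroup K} (hτa : τa ∈ κ.kerSubgroup)
    (huV : (γ₀ ^ p ^ n) ^ p ^ A * τa ∈ V) {f : ℕ}
    (hf : p ^ f • extFun κ n γ₀ c m ((γ₀ ^ p ^ n) ^ p ^ A * τa) = 0)
    {w : Field.absoluteGaloisGroup K} (hw : InS κ n γ₀ w) (hwV : w ∈ V)
    (hwL : w ∈ κ.layerSubgroup (n + (A + f))) : extFun κ n γ₀ c m w = 0 := by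
  obtain ⟨⟨k, τ⟩, hτ, rfl⟩ := hw
  dsimp only at hτ hwV hwL ⊢
  obtain ⟨j, hj⟩ := κ.pow_dvd_of_mem_layerSubgroup hγ₀ n (A + f) k hτ hwL
  set u : Field.absoluteGaloisGroup K := (γ₀ ^ p ^ n) ^ p ^ A * τa with hu_def
  have hu : InS κ n γ₀ u := inS_pow_mul (p ^ A) hτa
  set N : ℕ := j * p ^ f with hN
  -- `κ (u ^ N) = κ (γ^k τ)`
  have hκu : (κ u).toAdd = ((p ^ A : ℕ) : ℤ_[p]) * (p : ℤ_[p]) ^ n := κ.toAdd_map_pow_mul hγ₀ n _ hτa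
  have hw' : (u ^ N)⁻¹ * ((γ₀ ^ p ^ n) ^ k * τ) ∈ κ.kerSubgroup := by
    rw [ZpExtension.mem_kerSubgroup, map_mul, map_inv, map_pow κ]
    apply Multiplicative.toAdd.injective
    rw [toAdd_mul, toAdd_inv, toAdd_pow, κ.toAdd_map_pow_mul hγ₀ n k hτ, hκu, toAdd_one, hj, hN,
      nsmul_eq_mul]
    push_cast
    ring
  have e : (γ₀ ^ p ^ n) ^ k * τ = u ^ N * ((u ^ N)⁻¹ * ((γ₀ ^ p ^ n) ^ k * τ)) := by
    rw [mul_inv_cancel_left]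
  have hw'V : (u ^ N)⁻¹ * ((γ₀ ^ p ^ n) ^ k * τ) ∈ V := mul_mem (inv_mem (V.pow_mem huV N)) hwV
  rw [e, extFun_mul hγ₀ hm (hu.pow N) (inS_of_mem hw'), extFun_pow hγ₀ hm V hVm hVc hu huV N,
    extFun_of_mem hγ₀ hw', hVZ _ hw'V hw', smul_zero, add_zero, hN, mul_nsmul', hf, nsmul_zero]

omit [CharZero K] in
/-- **Independence of the representative**: if `s, s' ∈ S` and `s⁻¹ s'` lies in a subgroup on
whose intersection with `S` the function `extFun` vanishes, then `extFun s = extFun s'`.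
[folklore] -/
theorem extFun_eq_of_inv_mul_mem (hγ₀ : κ.IsTopGenerator γ₀)
    (hm : ∀ τ : κ.kerSubgroup, γ₀ ^ p ^ n • c.1 (subgroupConj κ.kerSubgroup (γ₀ ^ p ^ n) τ) - c.1 τ =
      (τ : Field.absoluteGaloisGroup K) • m - m)
    (Vf : Subgroup (Field.absoluteGaloisGroup K))
    (hvan : ∀ w, InS κ n γ₀ w → w ∈ Vf → extFun κ n γ₀ c m w = 0)
    {s s' : Field.absoluteGaloisGroup K} (hs : InS κ n γ₀ s) (hs' : InS κ n γ₀ s')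
    (h : s⁻¹ * s' ∈ Vf) : extFun κ n γ₀ c m s = extFun κ n γ₀ c m s' := by
  -- the case `k ≤ k'`
  have aux : ∀ (k d : ℕ) (τ τ' : Field.absoluteGaloisGroup K), τ ∈ κ.kerSubgroup →
      τ' ∈ κ.kerSubgroup →
      ((γ₀ ^ p ^ n) ^ k * τ)⁻¹ * ((γ₀ ^ p ^ n) ^ (k + d) * τ') ∈ Vf →
      extFun κ n γ₀ c m ((γ₀ ^ p ^ n) ^ k * τ) =
        extFun κ n γ₀ c m ((γ₀ ^ p ^ n) ^ (k + d) * τ') := by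
    intro k d τ τ' hτ hτ' hmem
    have hw : InS κ n γ₀ (((γ₀ ^ p ^ n) ^ k * τ)⁻¹ * ((γ₀ ^ p ^ n) ^ (k + d) * τ')) :=
      ⟨(d, ((γ₀ ^ p ^ n) ^ d)⁻¹ * τ⁻¹ * (γ₀ ^ p ^ n) ^ d * τ'),
        mul_mem (conj_pow_mem d (inv_mem hτ)) hτ', by dsimp only; rw [pow_add]; group⟩
    have h2 := extFun_mul hγ₀ hm (inS_pow_mul k hτ) hw
    rw [mul_inv_cancel_left, hvan _ hw hmem, smul_zero, add_zero] at h2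
    exact h2.symm
  obtain ⟨⟨k, τ⟩, hτ, rfl⟩ := hs
  obtain ⟨⟨k', τ'⟩, hτ', rfl⟩ := hs'
  dsimp only at hτ hτ' h ⊢
  rcases le_total k k' with hle | hle
  · obtain ⟨d, rfl⟩ := Nat.exists_eq_add_of_le hle
    exact aux k d τ τ' hτ hτ' h
  · obtain ⟨d, rfl⟩ := Nat.exists_eq_add_of_le hle
    have h' : ((γ₀ ^ p ^ n) ^ k' * τ')⁻¹ * ((γ₀ ^ p ^ n) ^ (k' + d) * τ) ∈ Vf := by
      have := inv_mem h
      rwa [mul_inv_rev, inv_inv] at this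
    exact (aux k' d τ' τ hτ' hτ h').symm

/-! ## The small open normal subgroup `V` -/

variable (κ)

/-- **A small open normal subgroup.** For a continuous cocycle `c` on `Gal(K̄/K_∞)` with values in
a discrete `Γ_K`-module with continuous orbit maps and `m ∈ M`, there is an open normal subgroup
`V` of `Γ_K` fixing `m` and every value of `c` (finitely many: `Gal(K̄/K_∞)` is compact) and
meeting `Gal(K̄/K_∞)` inside the zero set of `c` — `Γ_K` being profinite, every open
neighbourhood of `1` contains an open normal subgroup
(`ProfiniteGrp.exist_openNormalSubgroup_sub_open_nhds_of_one`). Serre, *Galois Cohomology*,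
I.§1.1 and I.§2.2. [folklore] -/
theorem exists_good_subgroup
    (hcont : ∀ m : M, Continuous fun g : Field.absoluteGaloisGroup K ↦ g • m)
    (c : contOneCocycles (discreteTopRep κ.kerSubgroup M)) (m : M) :
    ∃ V : Subgroup (Field.absoluteGaloisGroup K), V.Normal ∧
      IsOpen (V : Set (Field.absoluteGaloisGroup K)) ∧
      (∀ v ∈ V, v • m = m) ∧ (∀ v ∈ V, ∀ τ : κ.kerSubgroup, v • c.1 τ = c.1 τ) ∧
      (∀ v ∈ V, ∀ hv : v ∈ κ.kerSubgroup, c.1 ⟨v, hv⟩ = 0) := by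
  -- the three open neighbourhoods of `1`
  have hO₁ : IsOpen {g : Field.absoluteGaloisGroup K | g • m = m} :=
    (isOpen_discrete ({m} : Set M)).preimage (hcont m)
  haveI : CompactSpace κ.kerSubgroup :=
    isCompact_iff_compactSpace.mp κ.isClosed_kerSubgroup.isCompact
  have hfin : (Set.range c.1).Finite := (isCompact_range c.1.continuous).finite_of_discrete
  have hO₂ : IsOpen (⋂ v ∈ Set.range c.1, {g : Field.absoluteGaloisGroup K | g • v = v}) :=
    hfin.isOpen_biInter fun v _ ↦ (isOpen_discrete ({v} : Set M)).preimage (hcont v)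
  obtain ⟨t, ht, htZ⟩ := isOpen_induced_iff.mp (ResKernel.isOpen_zeroSubgroup c)
  have hO : IsOpen ({g : Field.absoluteGaloisGroup K | g • m = m} ∩
      (⋂ v ∈ Set.range c.1, {g : Field.absoluteGaloisGroup K | g • v = v}) ∩ t) :=
    (hO₁.inter hO₂).inter ht
  have h1 : (1 : Field.absoluteGaloisGroup K) ∈ {g : Field.absoluteGaloisGroup K | g • m = m} ∩
      (⋂ v ∈ Set.range c.1, {g : Field.absoluteGaloisGroup K | g • v = v}) ∩ t := by
    refine ⟨⟨one_smul _ _, ?_⟩, ?_⟩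
    · simp only [Set.mem_iInter, Set.mem_setOf_eq, one_smul, implies_true]
    · have h1Z : (1 : κ.kerSubgroup) ∈ (ResKernel.zeroSubgroup c : Set κ.kerSubgroup) := one_mem _
      rw [← htZ] at h1Z
      exact h1Z
  obtain ⟨V, hV⟩ := ProfiniteGrp.exist_openNormalSubgroup_sub_open_nhds_of_one hO h1
  refine ⟨V.toOpenSubgroup.toSubgroup, inferInstance, V.toOpenSubgroup.isOpen, ?_, ?_, ?_⟩
  · intro v hv
    exact (hV hv).1.1
  · intro v hv τ
    have h := (hV hv).1.2
    simp only [Set.mem_iInter, Set.mem_setOf_eq] at h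
    exact h (c.1 τ) ⟨τ, rfl⟩
  · intro v hv hvH
    have h : v ∈ t := (hV hv).2
    have h' : (⟨v, hvH⟩ : κ.kerSubgroup) ∈ (ResKernel.zeroSubgroup c : Set κ.kerSubgroup) := by
      rw [← htZ]
      exact h
    exact (ResKernel.mem_zeroSubgroup_iff c _).mp h'

/-! ## The extension -/

/-- **Extension of a `γ`-invariant cocycle from `Gal(K̄/K_∞)` to `Gal(K̄/K_n)`.** Let `M` be a
discrete `p`-primary `Γ_K`-module with continuous orbit maps, `c` a continuous cocycle on
`H = Gal(K̄/K_∞) = ker κ` and `m ∈ M` with `γ c(γ⁻¹ τ γ) - c(τ) = τ m - m` on `H` (`γ = γ₀^{pⁿ}`,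
`κ γ₀ = 1`; i.e. the class of `c` is fixed by `γ`). Then `c` is the restriction of a continuous
cocycle on `H' = Gal(K̄/K_n)`: `b(s v) = extFun s` for `s ∈ S = {γ^k τ}`, `v ∈ V_f`
(`exists_eq_pow_mul_mul`, `extFun_eq_of_inv_mul_mem`, `extFun_eq_zero`); `b` is constant on cosets
of the open subgroup `V_f`, hence continuous, and a cocycle by `extFun_mul`. This is the vanishing
of the obstruction in `H²(H'/H, M^H) = H²(ℤ_p, B) = 0` made explicit. Serre, *Galois Cohomology*,
I.§2.6 and I.§3.4; Greenberg (1999), §3, proof of Lemma 3.2 ("`Γ_n ≅ ℤ_p` is a free pro-`p`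
group. Hence `H²(Γ_n, B) = 0`"). [cite: GreenbergLNM1716, §3 Lemma 3.2] -/
theorem exists_extend {γ₀ : Field.absoluteGaloisGroup K} (hγ₀ : κ.IsTopGenerator γ₀) (n : ℕ)
    (hcont : ∀ m : M, Continuous fun g : Field.absoluteGaloisGroup K ↦ g • m)
    (hprim : ∀ m : M, ∃ k : ℕ, p ^ k • m = 0)
    (c : contOneCocycles (discreteTopRep κ.kerSubgroup M)) (m : M)
    (hm : ∀ τ : κ.kerSubgroup, γ₀ ^ p ^ n • c.1 (subgroupConj κ.kerSubgroup (γ₀ ^ p ^ n) τ) - c.1 τ =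
      (τ : Field.absoluteGaloisGroup K) • m - m) :
    ∃ b : contOneCocycles (discreteTopRep (κ.layerSubgroup n) M),
      ∀ (τ : Field.absoluteGaloisGroup K) (hτ : τ ∈ κ.kerSubgroup),
        b.1 ⟨τ, κ.kerSubgroup_le_layerSubgroup n hτ⟩ = c.1 ⟨τ, hτ⟩ := by
  -- Step A: the small open normal subgroup `V`
  obtain ⟨V, hVN, hVo, hVm, hVc, hVZ⟩ := exists_good_subgroup κ hcont c m
  haveI := hVN
  -- Step C: an element `u = γ^{p^A} τa ∈ V ∩ S` and `f` with `p^f • extFun u = 0`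
  obtain ⟨A, hA⟩ := κ.exists_forall_exists_toAdd_eq V hVo
  obtain ⟨u, huV, hu⟩ := hA ((p : ℤ_[p]) ^ n)
  have hτa : ((γ₀ ^ p ^ n) ^ p ^ A)⁻¹ * u ∈ κ.kerSubgroup := by
    rw [ZpExtension.mem_kerSubgroup, map_mul, map_inv]
    apply Multiplicative.toAdd.injective
    rw [toAdd_mul, toAdd_inv, κ.toAdd_map_pow_pow hγ₀, hu, toAdd_one, Nat.cast_pow, neg_add_cancel]
  have hu_eq : (γ₀ ^ p ^ n) ^ p ^ A * (((γ₀ ^ p ^ n) ^ p ^ A)⁻¹ * u) = u := mul_inv_cancel_left _ _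
  have huV' : (γ₀ ^ p ^ n) ^ p ^ A * (((γ₀ ^ p ^ n) ^ p ^ A)⁻¹ * u) ∈ V := by rwa [hu_eq]
  obtain ⟨f, hf⟩ := hprim (extFun κ n γ₀ c m ((γ₀ ^ p ^ n) ^ p ^ A * (((γ₀ ^ p ^ n) ^ p ^ A)⁻¹ * u)))
  -- the deep open normal subgroup `V_f`
  set Vf : Subgroup (Field.absoluteGaloisGroup K) := V ⊓ κ.layerSubgroup (n + (A + f)) with hVf
  have hVfo : IsOpen (Vf : Set (Field.absoluteGaloisGroup K)) := by
    rw [hVf, Subgroup.coe_inf]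
    exact hVo.inter (κ.isOpen_layerSubgroup _)
  have hVfN : Vf.Normal := Subgroup.normal_inf_normal V (κ.layerSubgroup (n + (A + f)))
  have hvan : ∀ w, InS κ n γ₀ w → w ∈ Vf → extFun κ n γ₀ c m w = 0 := fun w hw hwV ↦
    extFun_eq_zero hγ₀ hm V hVm hVc hVZ hτa huV' hf hw hwV.1 hwV.2
  -- covering `H' = S · V_f`
  choose kx τx vx hτx hvx hx using fun x : κ.layerSubgroup n ↦
    κ.exists_eq_pow_mul_mul hγ₀ n Vf hVfo x.2
  -- the function
  let bfun : κ.layerSubgroup n → M := fun x ↦ extFun κ n γ₀ c m ((γ₀ ^ p ^ n) ^ kx x * τx x)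
  have hF2 : ∀ (x : κ.layerSubgroup n) {s : Field.absoluteGaloisGroup K}, InS κ n γ₀ s →
      s⁻¹ * (x : Field.absoluteGaloisGroup K) ∈ Vf → bfun x = extFun κ n γ₀ c m s := by
    intro x s hs hsx
    refine (extFun_eq_of_inv_mul_mem hγ₀ hm Vf hvan hs (inS_pow_mul (kx x) (hτx x)) ?_).symm
    have e : s⁻¹ * ((γ₀ ^ p ^ n) ^ kx x * τx x) =
        s⁻¹ * (x : Field.absoluteGaloisGroup K) * (vx x)⁻¹ := by
      conv_lhs => rw [show (γ₀ ^ p ^ n) ^ kx x * τx x =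
        (x : Field.absoluteGaloisGroup K) * (vx x)⁻¹ by rw [hx x, mul_inv_cancel_right]]
      rw [mul_assoc]
    rw [e]
    exact mul_mem hsx (inv_mem (hvx x))
  have hF3 : ∀ x y : κ.layerSubgroup n,
      (x : Field.absoluteGaloisGroup K)⁻¹ * y ∈ Vf → bfun y = bfun x := by
    intro x y hxy
    refine hF2 y (inS_pow_mul (kx x) (hτx x)) ?_
    have e : ((γ₀ ^ p ^ n) ^ kx x * τx x)⁻¹ * (y : Field.absoluteGaloisGroup K) =
        vx x * ((x : Field.absoluteGaloisGroup K)⁻¹ * y) := by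
      conv_lhs => rw [show (γ₀ ^ p ^ n) ^ kx x * τx x =
        (x : Field.absoluteGaloisGroup K) * (vx x)⁻¹ by rw [hx x, mul_inv_cancel_right]]
      group
    rw [e]
    exact mul_mem (hvx x) hxy
  have hcontb : Continuous bfun := by
    refine IsLocallyConstant.continuous ((IsLocallyConstant.iff_exists_open bfun).mpr fun x ↦ ?_)
    refine ⟨{y | (x : Field.absoluteGaloisGroup K)⁻¹ * y ∈ Vf}, ?_, ?_, fun y hy ↦ hF3 x y hy⟩
    · exact hVfo.preimage (continuous_const.mul continuous_subtype_val)
    · show (x : Field.absoluteGaloisGroup K)⁻¹ * x ∈ Vf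
      rw [inv_mul_cancel]
      exact one_mem _
  have hF4 : ∀ x y : κ.layerSubgroup n,
      bfun (x * y) = bfun x + (x : Field.absoluteGaloisGroup K) • bfun y := by
    intro x y
    have hst : InS κ n γ₀ (((γ₀ ^ p ^ n) ^ kx x * τx x) * ((γ₀ ^ p ^ n) ^ kx y * τx y)) :=
      (inS_pow_mul (kx x) (hτx x)).mul (inS_pow_mul (kx y) (hτx y))
    have hmem : (((γ₀ ^ p ^ n) ^ kx x * τx x) * ((γ₀ ^ p ^ n) ^ kx y * τx y))⁻¹ *
        ((x * y : κ.layerSubgroup n) : Field.absoluteGaloisGroup K) ∈ Vf := by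
      have e : (((γ₀ ^ p ^ n) ^ kx x * τx x) * ((γ₀ ^ p ^ n) ^ kx y * τx y))⁻¹ *
          ((x * y : κ.layerSubgroup n) : Field.absoluteGaloisGroup K) =
          ((γ₀ ^ p ^ n) ^ kx y * τx y)⁻¹ * vx x * ((γ₀ ^ p ^ n) ^ kx y * τx y) * vx y := by
        rw [Subgroup.coe_mul]
        conv_lhs => rw [hx x, hx y]
        group
      rw [e]
      refine mul_mem ?_ (hvx y)
      have := hVfN.conj_mem (vx x) (hvx x) ((γ₀ ^ p ^ n) ^ kx y * τx y)⁻¹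
      rwa [inv_inv] at this
    rw [hF2 (x * y) hst hmem, extFun_mul hγ₀ hm (inS_pow_mul (kx x) (hτx x))
      (inS_pow_mul (kx y) (hτx y))]
    -- `x • bfun y = s • bfun y` since `v` fixes the values
    have hv : vx x ∈ V := (hvx x).1
    have e3 : (x : Field.absoluteGaloisGroup K) • bfun y =
        ((γ₀ ^ p ^ n) ^ kx x * τx x) • bfun y := by
      conv_lhs => rw [hx x]
      rw [mul_smul, smul_extFun hγ₀ V hVm hVc hv (inS_pow_mul (kx y) (hτx y))]
    rw [e3]
  refine ⟨⟨⟨bfun, hcontb⟩, fun x y ↦ hF4 x y⟩, fun τ hτ ↦ ?_⟩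
  -- restriction to `H`
  show bfun ⟨τ, κ.kerSubgroup_le_layerSubgroup n hτ⟩ = c.1 ⟨τ, hτ⟩
  rw [hF2 ⟨τ, κ.kerSubgroup_le_layerSubgroup n hτ⟩ (inS_of_mem hτ)
    (by rw [inv_mul_cancel]; exact one_mem _), extFun_of_mem hγ₀ hτ]

/-! ## Surjectivity of restriction onto the `γ`-invariants -/

omit [CharZero K] [TopologicalSpace M] [DiscreteTopology M] in
/-- The compatibility of the pair `(σ⁻¹ (·) σ, σ • ·)` defining `conjH1` (restated).
Serre, *Galois Cohomology*, I.§2.5. [folklore] -/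
theorem conj_compat (H : Subgroup (Field.absoluteGaloisGroup K)) [H.Normal]
    (σ : Field.absoluteGaloisGroup K) (x : H) (v : M) :
    DistribSMul.toAddMonoidHom M σ (subgroupConj H σ x • v) = x • DistribSMul.toAddMonoidHom M σ v := by
  simp only [DistribSMul.toAddMonoidHom_apply, Subgroup.smul_def, subgroupConj_apply_coe, smul_smul,
    mul_assoc, mul_inv_cancel_left]

/-- **Restriction `H¹(Gal(K̄/K_n), M) → H¹(Gal(K̄/K_∞), M)` hits every class fixed by
`conj_{γ₀^{pⁿ}}`** (`M` discrete `p`-primary with continuous orbit maps, `κ` any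
`ℤ_p`-extension, `κ γ₀ = 1`): the cocycle-level extension `exists_extend`, transported through
the explicit description of `conjH1` and `resOfLe` on cocycles (`map_oneCocycleClass`,
`oneCocycleClass_eq_zero_iff`). Serre, *Galois Cohomology*, I.§2.6 (`H¹(G, A) → H¹(H, A)^{G/H}`
is onto when `H²(G/H, A^H) = 0`) and I.§3.4; Greenberg (1999), §3 Lemma 3.2.
[cite: GreenbergLNM1716, §3 Lemma 3.2] -/
theorem mem_range_resOfLe_of_conjH1_eq {γ₀ : Field.absoluteGaloisGroup K}
    (hγ₀ : κ.IsTopGenerator γ₀) (n : ℕ)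
    (hcont : ∀ m : M, Continuous fun g : Field.absoluteGaloisGroup K ↦ g • m)
    (hprim : ∀ m : M, ∃ k : ℕ, p ^ k • m = 0) (x : subgroupH1 κ.kerSubgroup M)
    (hx : conjH1 κ.kerSubgroup M (γ₀ ^ p ^ n) x = x) :
    x ∈ (resOfLe M (κ.kerSubgroup_le_layerSubgroup n)).range := by
  obtain ⟨c, rfl⟩ := oneCocycleClass_surjective _ x
  have hconj : conjH1 κ.kerSubgroup M (γ₀ ^ p ^ n) (oneCocycleClass _ c) =
      oneCocycleClass _ (contOneCocycles.pullback (subgroupConj κ.kerSubgroup (γ₀ ^ p ^ n))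
        (resHomOfEquivariant (subgroupConj κ.kerSubgroup (γ₀ ^ p ^ n))
          (DistribSMul.toAddMonoidHom M (γ₀ ^ p ^ n)) (conj_compat κ.kerSubgroup (γ₀ ^ p ^ n))) c) :=
    map_oneCocycleClass _ _ _ c
  rw [hconj, ← sub_eq_zero, ← oneCocycleClass_sub, oneCocycleClass_eq_zero_iff] at hx
  obtain ⟨m, hm⟩ := hx
  have hm' : ∀ τ : κ.kerSubgroup, γ₀ ^ p ^ n • c.1 (subgroupConj κ.kerSubgroup (γ₀ ^ p ^ n) τ) - c.1 τ =
      (τ : Field.absoluteGaloisGroup K) • m - m := by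
    intro τ
    have h := hm τ
    rw [Submodule.coe_sub, ContinuousMap.sub_apply, contOneCocycles.pullback_apply] at h
    exact h
  obtain ⟨b, hb⟩ := exists_extend κ hγ₀ n hcont hprim c m hm'
  refine ⟨oneCocycleClass _ b, ?_⟩
  have hres : resOfLe M (κ.kerSubgroup_le_layerSubgroup n) (oneCocycleClass _ b) =
      oneCocycleClass _ (contOneCocycles.pullback
        (subgroupInclusion (κ.kerSubgroup_le_layerSubgroup n))
        (resHomOfEquivariant (subgroupInclusion (κ.kerSubgroup_le_layerSubgroup n))
          (AddMonoidHom.id M) (fun _ _ ↦ rfl)) b) :=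
    map_oneCocycleClass _ _ _ b
  rw [hres]
  congr 1
  apply Subtype.ext
  ext τ
  rw [contOneCocycles.pullback_apply]
  exact hb τ τ.2

end Literature.NumberTheory.EllipticCurves.ZpExtension

/-! ## Discharge of Lemma 3.2 -/

namespace WeierstrassCurve

open Literature.NumberTheory.EllipticCurves

variable {K : Type u} [Field K] [NumberField K] (W : WeierstrassCurve K) {p : ℕ} [Fact p.Prime]
  (κ : ZpExtension K p)

/-- **Discharge of `WeierstrassCurve.Greenberg1999_layerInvariants_le_range`** (Greenberg's
Lemma 3.2, LNM 1716, §3, p. 86: "`Coker(h_n) = 0`"): every class in `H¹(K_∞, E[p^∞])^{Γ_n}`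
(`layerInvariants`: fixed by `conj_σ` for all `σ ∈ Gal(K̄/K_n)`) is a restriction from
`H¹(K_n, E[p^∞])`. Only the invariance under `γ₀^{pⁿ}` (`κ γ₀ = 1`, `ZpExtension.pow_mem_layerSubgroup`)
is used, through `ZpExtension.mem_range_resOfLe_of_conjH1_eq` for the discrete `p`-primary module
`M = E[p^∞]` (continuous orbit maps: `continuous_smul_geomPrimaryTorsion`). The hypotheses
`[W.IsElliptic]` and `κ.IsCyclotomic` are not needed. [cite: GreenbergLNM1716, §3 Lemma 3.2] -/
theorem Greenberg1999_layerInvariants_le_range_holds : W.Greenberg1999_layerInvariants_le_range κ := by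
  intro _ _ n x hx
  obtain ⟨γ₀, hγ₀⟩ := κ.surjective (Multiplicative.ofAdd 1)
  have hγ₀' : κ.IsTopGenerator γ₀ := hγ₀
  have hfix := (W.mem_layerInvariants_iff κ n x).mp hx _ (κ.pow_mem_layerSubgroup hγ₀' n)
  have hprim : ∀ m : geomPrimaryTorsion W p, ∃ k : ℕ, p ^ k • m = 0 := fun m ↦ by
    obtain ⟨k, hk⟩ := m.2
    exact ⟨k, Subtype.ext (by rw [AddSubgroupClass.coe_nsmul, hk, ZeroMemClass.coe_zero])⟩
  exact ZpExtension.mem_range_resOfLe_of_conjH1_eq κ hγ₀' n (W.continuous_smul_geomPrimaryTorsion p)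
    hprim x hfix

end WeierstrassCurve
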